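import Literature.Barriers.RiemannHypothesis.JensenPolynomialsChasse
import Literature.NumberTheory.LFunctions.RiemannHypothesisUpTo101
import Literature.NumberTheory.DiophantineGeometry.NamedHypothesesRHProofs
import HarnessLib

/-!
# `ξ₁ = xiSq` has no zeros in the closed right half-plane `Re z ≥ 0` (RH-FREE)

A zero of `ξ₁` is `z = (ρ-½)²` with `ζ(ρ) = 0`, `0 < Re ρ < 1` (tree `exists_zero_of_xiSq_eq_zero`);
`Re z = (Re ρ-½)² - (Im ρ)² ≥ 0` forces `|Im ρ| ≤ |Re ρ-½| < ½`, impossible: `ζ` has no real zero in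
`(0,1)` and every zero with `0 < |Im ρ| ≤ 101` is on the critical line (tree, kernel-certified,
`riemannHypothesisUpTo_hundredOne`), where `Re z = -(Im ρ)² < 0`. Input for the cell rh-jensen LOG-BAND
lines (zone Z3 «right of the axis»: the root of every backward Jensen chain of a zero of `ξ₁⁽ⁿ⁾` with
`Re z ≥ 0` lies in the LEFT half-plane). Nothing here bears on zeros of ζ off the line or the truth of RH.
(prover-rh-jensen-eng-2-g4-0, 2026-08-26.)
-/

noncomputable section

open Complex

set_option linter.dupNamespace false

namespace Summit.RiemannHypothesis.RiemannHypothesis.Theorems.JensenPolynomials.LogBand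

open Literature.NumberTheory.LFunctions Literature.Barriers.RiemannHypothesis
  Literature.NumberTheory.DiophantineGeometry

/-- **`ξ₁(z) ≠ 0` for `Re z ≥ 0`** (RH-FREE; uses the tree's kernel-certified RH up to height `101` (`decide +kernel`, standard axioms) only
to exclude zeros of `ζ` with `|Im ρ| < ½`). -/
theorem xiSq_ne_zero_of_re_nonneg {z : ℂ} (hz : 0 ≤ z.re) : xiSq z ≠ 0 := by
  intro h0
  obtain ⟨ρ, hζ, h0re, h1re, hρz⟩ := exists_zero_of_xiSq_eq_zero h0
  -- `Re z = (Re ρ - ½)² - (Im ρ)²`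
  have hre : z.re = (ρ.re - 1 / 2) ^ 2 - ρ.im ^ 2 := by
    rw [← hρz]; simp [sq, Complex.mul_re]
  have hRH := riemannHypothesisUpTo_hundredOne
  rcases lt_trichotomy ρ.im 0 with hneg | hzero | hpos
  · -- lower half-plane: conjugate zero is on the line
    have hhalf : ρ.re = 1 / 2 :=
      RiemannHypothesisUpTo.re_eq_of_im_neg hRH hζ hneg (by nlinarith)
    rw [hhalf] at hre
    have : z.re < 0 := by rw [hre]; nlinarith
    linarith
  · -- real zero in (0,1): impossible
    exact riemannZeta_ne_zero_of_im_eq_zero_of_pos_of_lt_one hzero h0re h1re hζ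
  · have hhalf : ρ.re = 1 / 2 := hRH ρ hζ hpos (by nlinarith)
    rw [hhalf] at hre
    have : z.re < 0 := by rw [hre]; nlinarith
    linarith

/-- Hence every zero of `ξ₁` has `Re z < 0` (RH-FREE). -/
theorem re_neg_of_xiSq_eq_zero {z : ℂ} (hz : xiSq z = 0) : z.re < 0 := by
  by_contra h
  exact xiSq_ne_zero_of_re_nonneg (not_lt.1 h) hz

end Summit.RiemannHypothesis.RiemannHypothesis.Theorems.JensenPolynomials.LogBand
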